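import Summits.CriticalPhenomena.PercolationContinuityZ3.Theorems.PercNearOneGluingNoHeavyPcintMemoryTailGrowth
import Literature.Probability.RandomPlanarGeometry.HexSAWBrickWallStripFugacityLevel0Zero
import HarnessLib

/-!
# CriticalPhenomena/PercolationContinuityZ3 — Theorems/PercNearOneGluingNoHeavyPcintMemAutomatonExact.lean: the dangerous-set automaton accepts EXACTLY the memory-`τ` words (`cnt(∅, n) = c_{n,τ}`), and the LOWER Collatz–Wielandt certificate `μ_τ(d) ≥ num/den`

Lane prim-pcint, infrastructure.  The tree's …PcintMemAutomaton proves one direction — memory-`τ` words are accepted by the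
dangerous-set automaton `mstep τ` from `∅` (`runW_mstep_of_isMem`) — which is all the UPPER certificates of the lane need
(`c_{n,τ} ≤ cnt(∅, n) ≤ (num/den)ⁿ·V(∅)/m`, `cnt_le_of_certificate`: upper bounds on `μ_τ`, hence lower bounds on
`p_c ≥ 1/μ_τ`).  The STRUCTURE programme now also needs LOWER bounds on `μ_τ` (upper bounds on the rung costs `Δ_τ`, the
upper half `R_τ < 1` of the typed window of C4 and clause (c) `R_{τ+2} < R_τ` at `τ ≥ 6`, where no closed form exists): this
file supplies the two missing pieces.

* **`isMem_of_runW_isSome`**: an accepted word has memory `τ` (`τ ≥ 2`) — at each step the automaton refuses exactly the letters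
  landing on a site remembered with age `≤ τ − 1` (a return at gap `≤ τ`); with the tree's direction, `runW (mstep τ) n ∅ w` is
  `some _` IFF `IsMem τ w` (`runW_isSome_iff_isMem`) and **`cnt_mstep_empty_eq_memCount`: `cnt (mstep τ) ∅ n = c_{n,τ}(d)`**.
* **`cnt_ge_of_subcertificate`** (dual of `cnt_le_of_certificate`): if `R` is closed under `step`, `num·V(S) ≤ den·Σ_a V(step S a)`
  on `R` and `V ≤ M` on `R`, then `numⁿ·V(S) ≤ M·denⁿ·cnt(S, n)`.
* **`le_memGrowth_of_subcertificate`**: a sub-certificate on a closed set of states containing `∅` with `V(∅) ≥ 1` gives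
  `num/den ≤ μ_τ(d)` (via `μ_τ = lim c_{n,τ}^{1/n}`, `tendsto_memCount_rpow`).

HONEST FRAMING: bookkeeping; no certificate is run here.  Written by prim-pcint-2 gen 17 (prover-prim-pcint-2-g17-0), 2026-08-25.
-/

noncomputable section

open Filter Topology
open Literature.Probability.LatticeModels Literature.Probability.Percolation
open Literature.Probability.FitznerVanDerHofstad2017 (wordPos_wordInit)

namespace Summit.CriticalPhenomena.PercolationContinuityZ3.Theorems.Pcint

/-! ### The lower Collatz–Wielandt bound for an abstract automaton -/

section Automaton

variable {σ α : Type*}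

/-- **Lower Collatz–Wielandt counting bound.** If `R` is closed under `step`, `V` is a SUB-solution
`num · V S ≤ den · Σ_a V(step S a)` on `R`, and `V ≤ M` on `R`, then `numⁿ · V S ≤ M · denⁿ · cnt S n` for every `S ∈ R`.
[folklore] -/
theorem cnt_ge_of_subcertificate [Fintype α] (step : σ → α → Option σ) (R : Set σ)
    (hR : ∀ S ∈ R, ∀ a T, step S a = some T → T ∈ R) (V : σ → ℕ) (num den M : ℕ)
    (hV : ∀ S ∈ R, num * V S ≤ den * (∑ a, optVal V (step S a)))
    (hM : ∀ S ∈ R, V S ≤ M) :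
    ∀ (n : ℕ), ∀ S ∈ R, num ^ n * V S ≤ M * den ^ n * cnt step S n := by
  intro n
  induction n with
  | zero => intro S hS; simpa [cnt] using hM S hS
  | succ n ih =>
    intro S hS
    have key : num ^ n * (∑ a, optVal V (step S a)) ≤ M * den ^ n * cnt step S (n + 1) := by
      rw [cnt, Finset.mul_sum, Finset.mul_sum]
      refine Finset.sum_le_sum fun a _ => ?_
      cases hSa : step S a with
      | none => simp
      | some T => exact ih T (hR S hS a T hSa)
    calc num ^ (n + 1) * V S = num ^ n * (num * V S) := by rw [pow_succ]; ring
      _ ≤ num ^ n * (den * ∑ a, optVal V (step S a)) := Nat.mul_le_mul_left _ (hV S hS)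
      _ = den * (num ^ n * ∑ a, optVal V (step S a)) := by ring
      _ ≤ den * (M * den ^ n * cnt step S (n + 1)) := Nat.mul_le_mul_left _ key
      _ = M * den ^ (n + 1) * cnt step S (n + 1) := by rw [pow_succ]; ring

end Automaton

/-! ### The automaton accepts exactly the memory-`τ` words -/

variable {d : ℕ}

/-- **An accepted word has memory `τ`** (`τ ≥ 2`): the converse of `runW_mstep_of_isMem`. [folklore] -/
theorem isMem_of_runW_isSome {τ : ℕ} (hτ : 2 ≤ τ) :
    ∀ {n : ℕ} (w : Fin n → Fin d × Bool), (runW (mstep τ) n ∅ w).isSome → IsMem τ w := by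
  intro n
  induction n with
  | zero => intro w _ i j hj hij _; omega
  | succ n ih =>
    intro w h
    rw [runW_succ, show Fin.init w = wordInit w from rfl] at h
    -- the prefix is accepted, hence memory-τ, hence its run ends in its dangerous set
    have hinit : (runW (mstep τ) n ∅ (wordInit w)).isSome := by
      cases hr : runW (mstep τ) n ∅ (wordInit w) with
      | none => rw [hr] at h; exact absurd h (by simp)
      | some T => rfl
    have hmem : IsMem τ (wordInit w) := ih (wordInit w) hinit
    rw [runW_mstep_of_isMem hτ (wordInit w) hmem, Option.bind_some] at h
    -- the last letter is allowed from the dangerous set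
    have hallowed : ¬ ∃ q ∈ danger τ (wordInit w), q.1 = stepVec (w (Fin.last n)) := by
      intro hex
      unfold mstep at h
      rw [if_pos hex] at h
      exact absurd h (by simp)
    have hlast : wordPos w (n + 1) = wordPos w n + stepVec (w (Fin.last n)) := wordPos_succ w (Nat.lt_succ_self n)
    intro i j hj hij hijτ heq
    by_cases hjn : j ≤ n
    · -- both sites belong to the prefix
      exact hmem i j hjn hij hijτ (by rwa [wordPos_wordInit w (by omega), wordPos_wordInit w hjn])
    · have hj' : j = n + 1 := by omega
      subst hj'
      by_cases hin : i = n
      · subst hin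
        rw [hlast] at heq
        have h0 : stepVec (w (Fin.last i)) = 0 := by
          have := congrArg (fun x => x - wordPos w i) heq
          simpa using this.symm
        have := l1_stepVec (w (Fin.last i))
        rw [h0] at this
        simp [l1] at this
      · -- a remembered site of age `n − i ∈ [1, τ−1]` equals the landing site: refused
        apply hallowed
        refine ⟨(wordPos w i - wordPos w n, n - i), ?_, ?_⟩
        · rw [mem_danger]
          refine ⟨by omega, by omega, by omega, ?_, ?_⟩
          · show wordPos w i - wordPos w n = wordPos (wordInit w) (n - (n - i)) - wordPos (wordInit w) n
            rw [wordPos_wordInit w (by omega), wordPos_wordInit w le_rfl, show n - (n - i) = i by omega]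
          · show l1 (wordPos w i - wordPos w n) ≤ τ - (n - i)
            rw [heq, hlast, add_sub_cancel_left, l1_stepVec]
            omega
        · show wordPos w i - wordPos w n = stepVec (w (Fin.last n))
          rw [heq, hlast, add_sub_cancel_left]

/-- **`runW (mstep τ) n ∅ w` succeeds iff `w` has memory `τ`** (`τ ≥ 2`). [folklore] -/
theorem runW_isSome_iff_isMem {τ : ℕ} (hτ : 2 ≤ τ) {n : ℕ} (w : Fin n → Fin d × Bool) :
    (runW (mstep τ) n ∅ w).isSome ↔ IsMem τ w :=
  ⟨isMem_of_runW_isSome hτ w, fun h => by rw [runW_mstep_of_isMem hτ w h]; rfl⟩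

/-- **The automaton counts exactly the memory-`τ` words: `cnt (mstep τ) ∅ n = c_{n,τ}(d)`** (`τ ≥ 2`). [folklore] -/
theorem cnt_mstep_empty_eq_memCount {τ : ℕ} (hτ : 2 ≤ τ) (n : ℕ) :
    cnt (mstep τ) (∅ : MState d) n = MemoryTail.memCount d τ n := by
  classical
  rw [← card_accepted_eq_cnt, MemoryTail.memCount, MemoryTail.memWords, Fintype.card_subtype]
  congr 1
  ext w
  simp only [Finset.mem_filter, Finset.mem_univ, true_and]
  exact runW_isSome_iff_isMem hτ w

/-! ### Lower bounds on `μ_τ(d)` from sub-certificates -/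

/-- **A geometric lower bound on the counts bounds `μ_τ` from below**: if `c_{n,τ} ≥ ρⁿ/K` for all `n ≥ 1` (`K, ρ > 0`) then
`ρ ≤ μ_τ(d)` (`μ_τ = lim c_{n,τ}^{1/n}`). [folklore] -/
theorem le_memGrowth_of_geometric_le [NeZero d] {τ : ℕ} {K ρ : ℝ} (hK : 0 < K) (hρ : 0 < ρ)
    (h : ∀ n : ℕ, 1 ≤ n → ρ ^ n / K ≤ (MemoryTail.memCount d τ n : ℝ)) : ρ ≤ MemoryTail.memGrowth d τ := by
  have hlim := MemoryTail.tendsto_memCount_rpow (d := d) τ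
  have hlow : Tendsto (fun n : ℕ => (1 / K) ^ (1 / (n : ℝ)) * ρ) atTop (𝓝 ρ) := by
    have := (Literature.Probability.RandomPlanarGeometry.SAW.HexBW.tendsto_const_rpow_one_div_nat₀
      (one_div_pos.2 hK)).mul_const ρ
    rwa [one_mul] at this
  refine le_of_tendsto_of_tendsto hlow hlim (Filter.eventually_atTop.2 ⟨1, fun n hn => ?_⟩)
  show (1 / K) ^ (1 / (n : ℝ)) * ρ ≤ (MemoryTail.memCount d τ n : ℝ) ^ (1 / (n : ℝ))
  have hn0 : (0 : ℝ) < n := by exact_mod_cast (show 0 < n by omega)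
  have h1 : ((1 / K) ^ (1 / (n : ℝ)) * ρ) = (ρ ^ n / K) ^ (1 / (n : ℝ)) := by
    rw [div_eq_mul_one_div (ρ ^ n), Real.mul_rpow (pow_nonneg hρ.le n) (one_div_pos.2 hK).le, mul_comm]
    congr 1
    rw [← Real.rpow_natCast ρ n, ← Real.rpow_mul hρ.le, mul_one_div_cancel hn0.ne', Real.rpow_one]
  rw [h1]
  exact Real.rpow_le_rpow (div_nonneg (pow_nonneg hρ.le n) hK.le) (h n hn) (by positivity)

/-- **Lower Collatz–Wielandt certificate for `μ_τ(d)`**: a set `R` of states closed under `mstep τ` and containing `∅`, a weight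
`V ≤ M` on `R` with `V ∅ ≥ 1`, and the row inequalities `num · V S ≤ den · Σ_a V(mstep τ S a)` on `R` give `num/den ≤ μ_τ(d)`
(`τ ≥ 2`). [folklore] -/
theorem le_memGrowth_of_subcertificate [NeZero d] {τ : ℕ} (hτ : 2 ≤ τ) (R : Set (MState d))
    (hR : ∀ S ∈ R, ∀ a T, mstep τ S a = some T → T ∈ R) (h0 : (∅ : MState d) ∈ R) (V : MState d → ℕ)
    (num den M : ℕ) (hden : 0 < den) (hV0 : 1 ≤ V ∅)
    (hV : ∀ S ∈ R, num * V S ≤ den * (∑ a, optVal V (mstep τ S a))) (hM : ∀ S ∈ R, V S ≤ M) :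
    (num : ℝ) / den ≤ MemoryTail.memGrowth d τ := by
  have hM1 : 1 ≤ M := hV0.trans (hM ∅ h0)
  have hcert := cnt_ge_of_subcertificate (mstep τ) R hR V num den M hV hM
  rcases Nat.eq_zero_or_pos num with hnum | hnum
  · rw [hnum, Nat.cast_zero, zero_div]; exact MemoryTail.memGrowth_nonneg d τ
  refine le_memGrowth_of_geometric_le (K := M) (ρ := (num : ℝ) / den) (by exact_mod_cast hM1)
    (div_pos (by exact_mod_cast hnum) (by exact_mod_cast hden)) fun n _ => ?_
  have h := hcert n ∅ h0
  rw [cnt_mstep_empty_eq_memCount hτ] at h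
  -- num^n · V ∅ ≤ M den^n c  ⇒  (num/den)^n / M ≤ c
  have h' : ((num : ℝ) ^ n * (V ∅ : ℕ)) ≤ (M : ℝ) * (den : ℝ) ^ n * (MemoryTail.memCount d τ n : ℝ) := by
    exact_mod_cast h
  have hdn : (0 : ℝ) < (den : ℝ) ^ n := pow_pos (by exact_mod_cast hden) n
  have hMr : (0 : ℝ) < M := by exact_mod_cast hM1
  rw [div_pow, div_div, div_le_iff₀ (mul_pos hdn hMr)]
  have hV1 : (1 : ℝ) ≤ (V ∅ : ℕ) := by exact_mod_cast hV0
  nlinarith [pow_nonneg (Nat.cast_nonneg (α := ℝ) num) n]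

end Summit.CriticalPhenomena.PercolationContinuityZ3.Theorems.Pcint
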